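import Literature.Topology.FourManifolds.LefschetzBasePageCover
import Literature.Topology.FourManifolds.LefschetzBasePageCoverOverlap
import Literature.Topology.FourManifolds.LefschetzBaseHomologyRank
import Literature.Topology.FourManifolds.LefschetzBaseShadow
import Literature.AlgebraicTopology.SingularHomology.MayerVietorisFiveLemma
import HarnessLib

/-!
# `H₁(page g 1; ℤ) → H₁(Base g; ℤ)` is bijective (Kas' engine, design lemma (E) `Kas_page_iso`)
(sub-goal `stub_Kas_page_iso` of stub `stub_modelsOn_counts`, line `modp-braid-orbits`, reshape r9,
crux `ConvexBisection.AcyclicBisectionExists`, item stmt-SmoothPoincare4-10508; wave 4 / W4-E)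

Input (E) of the Kas design for clause 3 of NF2 (`work/stubs/Kas_Design.lean` of lead c3: the
base-page class map `P : ℤ^{2g} → H₁(seamOff h)` reads a vector through the chain shadow, pulls it
back to the page of direction `1` and pushes it into the seam): **the base page
`page g 1 = {‖x‖² < 4, w = 1/2} ⊂ ∂ Base g` carries the homology of the base** — the inclusion induces
isomorphisms `Hₖ₊₁(page g 1; M) ≅ Hₖ₊₁(Base g; M)` for every `k` and all coefficients
(`isIso_map_pageIncl_succ`), in particular a bijection on `H₁(−; ℤ)` (`stub_Kas_page_iso`, the
registered sub-goal, verbatim the design lemma `Kas_page_iso`).  On paper: the page is a copy of the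
open Milnor fibre `F_{g,1}` and `Base g ≅ F × D²` (Milnor 1968, Thm. 9.1).  In the tree: the Milnor
cover `Base g = U ∪ V` (`LefschetzBaseCover*.lean`: `U ≃ₕ Fin 2`, `V ≃ₕ Fin (2g+1)`,
`U ∩ V ≃ₕ Fin 2 × Fin (2g+1)` through index maps) is run inside the page
(`LefschetzBasePageCover.lean`, `LefschetzBasePageCoverOverlap.lean`: the traces `pageU`, `pageV`,
`pageU ∩ pageV` deformation retract inside the page onto sections of the SAME index maps), so the
three restricted inclusions are homology isomorphisms in all degrees (`isIso_map_of_deformation`: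
two-out-of-three for `e ∘ r` with `e`, `e ∘ r` homotopy equivalences), and the Mayer–Vietoris five
lemma (`isIso_singularHomology_map_succ_of_forall_isIso`, Hatcher §2.2 p. 150) concludes.
By-products: the page is path connected (`pathConnectedSpace_page`: sheet and branch points are
joined inside the page), so the comparison holds in EVERY degree (`isIso_map_pageIncl`);
`H₁(page g 1; ℤ)` is free of rank `2g` (`homologyOne_page`) and the chain shadow composed with the
inclusion is a bijection `H₁(page g 1; ℤ) ≅ ℤ^{2g}` (`bijective_shadow_comp_map_page`) — the
ingredients of the base-page class map `pageClassMap` of the design.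

No definitions, no named facts, no `sorry`.
-/

noncomputable section

-- the prescribed namespace `Summit.<P>.<Sub>.…` duplicates `SmoothPoincare4` (P = Sub)
set_option linter.dupNamespace false

open scoped Manifold ContDiff Topology
open Set Function CategoryTheory CategoryTheory.Limits
open Literature.Topology.FourManifolds Literature.Topology.FourManifolds.LefschetzBase
  Literature.AlgebraicTopology.SingularHomology Literature.Topology.FourManifolds.TorusKnotMilnor

namespace Summit.SmoothPoincare4.SmoothPoincare4.Theorems.AcyclicBisectionExists.ModpBraidOrbits

universe v

variable (R : Type v) [CommRing R] (M : Type v) [AddCommGroup M] [Module R M]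

/-! ## Two-out-of-three for homotopy equivalences with a discrete space -/

/-- **Homology isomorphism from a common deformation.**  Let `e : S ≃ₕ ι` be a homotopy equivalence
and `r : S' → S`.  If `e ∘ r` admits a section `sec` onto which `S'` deformation retracts
(`id_{S'} ≃ sec ∘ e ∘ r`), then `e ∘ r` is a homotopy equivalence too and `r_* : Hⱼ(S') → Hⱼ(S)` is an
isomorphism for every `j`. [cite: HatcherAT2002, §2.1 Cor. 2.11] -/
theorem isIso_map_of_deformation {S S' ι : Type} [TopologicalSpace S] [TopologicalSpace S']
    [TopologicalSpace ι] (r : C(S', S)) (e : ContinuousMap.HomotopyEquiv S ι) (sec : C(ι, S'))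
    (hsec : ∀ i, e.toFun (r (sec i)) = i)
    (H : ContinuousMap.Homotopy (ContinuousMap.id S') (sec.comp (e.toFun.comp r))) (j : ℕ) :
    IsIso (singularHomology.map R M r j) := by
  let e' : ContinuousMap.HomotopyEquiv S' ι :=
    { toFun := e.toFun.comp r
      invFun := sec
      left_inv := ⟨H.symm⟩
      right_inv := by
        rw [show (e.toFun.comp r).comp sec = ContinuousMap.id ι from ContinuousMap.ext hsec] }
  have h1 : IsIso (singularHomology.map R M (e.toFun.comp r) j) :=
    (singularHomology.isoOfHomotopyEquiv R M e' j).isIso_hom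
  haveI h2 : IsIso (singularHomology.map R M e.toFun j) :=
    (singularHomology.isoOfHomotopyEquiv R M e j).isIso_hom
  rw [singularHomology.map_comp] at h1
  exact IsIso.of_isIso_comp_right _ (singularHomology.map R M e.toFun j)

/-! ## The three restricted inclusions are homology isomorphisms -/

/-- The inclusion of the page maps `pageU` into `U`. [folklore] -/
theorem mapsTo_pageU (g : ℕ) :
    MapsTo (⟨Subtype.val, continuous_subtype_val⟩ : C(↥(page g 1), Base g)) (pageU g) (coverU g) :=
  fun _ hq => hq

/-- The inclusion of the page maps `pageV` into `V`. [folklore] -/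
theorem mapsTo_pageV (g : ℕ) :
    MapsTo (⟨Subtype.val, continuous_subtype_val⟩ : C(↥(page g 1), Base g)) (pageV g) (coverV g) :=
  fun _ hq => hq

/-- `pageU ∪ pageV` is the whole page (`U ∪ V = Base g`). [folklore] -/
theorem pageU_union_pageV (g : ℕ) : pageU g ∪ pageV g = univ :=
  eq_univ_of_forall fun q => show q.1 ∈ coverU g ∪ coverV g by rw [coverU_union_coverV]; exact mem_univ _

/-- **`Hⱼ(pageU g) ≅ Hⱼ(U)` by the inclusion, for all `j`** (both are `≃ₕ Fin 2` through the sheet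
sign; `homotopyPU`, `idxU_secPU`). [cite: Milnor1968, §9 Lemma 9.2] -/
theorem isIso_map_resPU (g j : ℕ) :
    IsIso (singularHomology.map R M (subsetRestrict _ (mapsTo_pageU g)) j) := by
  rw [show subsetRestrict _ (mapsTo_pageU g) = resPU g from ContinuousMap.ext fun _ => rfl]
  exact isIso_map_of_deformation R M (resPU g) (homotopyEquivU g) (secPU g) idxU_secPU (homotopyPU g) j

/-- **`Hⱼ(pageV g) ≅ Hⱼ(V)` by the inclusion, for all `j`** (both are `≃ₕ Fin (2g+1)` through the
sector root; `homotopyPV`, `idxV_secPV`). [cite: Milnor1968, §9 Lemma 9.2] -/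
theorem isIso_map_resPV (g j : ℕ) :
    IsIso (singularHomology.map R M (subsetRestrict _ (mapsTo_pageV g)) j) := by
  rw [show subsetRestrict _ (mapsTo_pageV g) = resPV g from ContinuousMap.ext fun _ => rfl]
  exact isIso_map_of_deformation R M (resPV g) (homotopyEquivV g) (secPV g) idxV_secPV (homotopyPV g) j

/-- **`Hⱼ(pageU g ∩ pageV g) ≅ Hⱼ(U ∩ V)` by the inclusion, for all `j`** (both are
`≃ₕ Fin 2 × Fin (2g+1)`; `homotopyPW`, `idxW_secPW`). [cite: Milnor1968, §9 Lemma 9.2] -/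
theorem isIso_map_resPW (g j : ℕ) :
    IsIso (singularHomology.map R M (subsetRestrict _ ((mapsTo_pageU g).inter_inter (mapsTo_pageV g))) j) := by
  rw [show subsetRestrict _ ((mapsTo_pageU g).inter_inter (mapsTo_pageV g)) = resPW g from
    ContinuousMap.ext fun _ => rfl]
  exact isIso_map_of_deformation R M (resPW g) (homotopyEquivW g) (secPW g) idxW_secPW (homotopyPW g) j

/-! ## The page carries the homology of the base -/

/-- **`Hₖ₊₁(page g 1; M) ≅ Hₖ₊₁(Base g; M)` by the inclusion**, for every `k` and all coefficients:
the Mayer–Vietoris five lemma for the map of covers `(pageU, pageV) → (U, V)` whose three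
restrictions are homology isomorphisms (Milnor 1968, Thm. 9.1: `Base g ≅ F × D²`, the page a copy of
`F`). [cite: Milnor1968, Thm. 9.1] -/
theorem isIso_map_pageIncl_succ (g k : ℕ) :
    IsIso (singularHomology.map R M (⟨Subtype.val, continuous_subtype_val⟩ : C(↥(page g 1), Base g))
      (k + 1)) :=
  isIso_singularHomology_map_succ_of_forall_isIso R M _ (mapsTo_pageU g) (mapsTo_pageV g)
    (by rw [(isOpen_pageU g).interior_eq, (isOpen_pageV g).interior_eq, pageU_union_pageV])
    (by rw [(isOpen_coverU g).interior_eq, (isOpen_coverV g).interior_eq, coverU_union_coverV])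
    (isIso_map_resPU R M g) (isIso_map_resPV R M g) (isIso_map_resPW R M g) k

/-- **`H₁(page g 1; ℤ) → H₁(Base g; ℤ)` is bijective** — design lemma (E) `Kas_page_iso` of the Kas
presentation. [cite: Milnor1968, Thm. 9.1] -/
theorem bijective_map_pageIncl_one (g : ℕ) :
    Function.Bijective (singularHomology.map ℤ ℤ
      (⟨Subtype.val, continuous_subtype_val⟩ : C(↥(page g 1), Base g)) 1) :=
  (ConcreteCategory.isIso_iff_bijective _).1 (isIso_map_pageIncl_succ ℤ ℤ g 0)

/-- **The chain shadow read on the page**: for a chain shadow `σ : H₁(Base g; ℤ) ≅ ℤ^{2g}` (Milnor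
1968, Thm. 9.1, `exists_isChainShadow_of`), `σ ∘ incl_* : H₁(page g 1; ℤ) → ℤ^{2g}` is a bijection.
[cite: Milnor1968, Thm. 9.1] -/
theorem bijective_shadow_comp_map_page (g : ℕ)
    {σ : singularHomology ℤ ℤ (Base g) 1 →ₗ[ℤ] (Fin g ⊕ Fin g → ℤ)} (hσ : IsChainShadow g σ) :
    Function.Bijective (σ ∘ₗ (singularHomology.map ℤ ℤ
      (⟨Subtype.val, continuous_subtype_val⟩ : C(↥(page g 1), Base g)) 1).hom) :=
  hσ.1.comp (bijective_map_pageIncl_one g)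

/-- **`H₁(page g 1; ℤ)` is free of rank `2g`** (it is `≅ H₁(Base g; ℤ) ≅ ℤ^{2g}`; Milnor 1968,
Thm. 9.1 for the fibre `F_{g,1}`). [cite: Milnor1968, Thm. 9.1] -/
theorem homologyOne_page (g : ℕ) :
    Module.Finite ℤ (singularHomology ℤ ℤ ↥(page g 1) 1) ∧ Module.Free ℤ (singularHomology ℤ ℤ ↥(page g 1) 1) ∧
      Module.finrank ℤ (singularHomology ℤ ℤ ↥(page g 1) 1) = 2 * g := by
  obtain ⟨σ, hσ⟩ := exists_isChainShadow_of g
  let e : singularHomology ℤ ℤ ↥(page g 1) 1 ≃ₗ[ℤ] (Fin g ⊕ Fin g → ℤ) :=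
    LinearEquiv.ofBijective _ (bijective_shadow_comp_map_page g hσ)
  refine ⟨Module.Finite.equiv e.symm, Module.Free.of_equiv e.symm, ?_⟩
  rw [e.finrank_eq, Module.finrank_pi, Fintype.card_sum, Fintype.card_fin]; ring

/-! ## The page is path connected, and the comparison in all degrees -/

/-- **Inside the base page, the `k`-th branch point `(ν μ^k (3/2)^{1/(2g+1)}, 0)` is joined to the
sheet point `(0, μ₂^j √(3/2))`** by the lift `r ↦ ((1 − r) ζ, μ₂^j √(3/2 · (1 − (1 − r)^{2g+1})))` of the
radius (`w = 1/2` along it, `‖x‖^{2g+1} ≤ 3/2`). [folklore] -/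
theorem joined_secPV_secPU {g : ℕ} (k : Fin (2 * g + 1)) (j : Fin 2) : Joined (secPV g k).1 (secPU g j).1 := by
  set ζ : ℂ := halfRoot (2 * g + 1) * rootU (2 * g + 1) ^ (k : ℕ) * prRoot (2 * g + 1) (3 / 2) with hζdef
  set s : ℂ := rootU 2 ^ (j : ℕ) with hsdef
  have hζ : ζ ^ (2 * g + 1) = -(3 / 2) := basePtPV_xpow g k
  have hs : s ^ 2 = 1 := rootU_pow_pow two_ne_zero j
  have hζn : ‖ζ‖ ^ (2 * g + 1) = 3 / 2 := by
    rw [← norm_pow, hζ, norm_neg, show (3 / 2 : ℂ) = ((3 / 2 : ℝ) : ℂ) by push_cast; ring, Complex.norm_real,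
      Real.norm_eq_abs, abs_of_pos (by norm_num)]
  let a : ℝ → ℂ := fun r => (((1 - r : ℝ)) : ℂ) * ζ
  let ρ : ℝ → ℝ := fun r => 3 / 2 * (1 - (1 - r) ^ (2 * g + 1))
  let b : ℝ → ℂ := fun r => s * csqrt ((ρ r : ℝ) : ℂ)
  have hw : ∀ r, b r ^ 2 - a r ^ (2 * g + 1) - 1 = 1 / 2 := fun r => by
    simp only [a, b, ρ]
    rw [mul_pow, hs, one_mul, csqrt_sq, mul_pow, hζ, ← Complex.ofReal_pow]; push_cast; ring
  have ha : ∀ r ∈ Icc (0 : ℝ) 1, ‖a r‖ ^ (2 * g + 1) < 2 ^ (2 * g + 1) := fun r ⟨hr0, hr1⟩ => by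
    simp only [a]
    rw [norm_mul, mul_pow, hζn, Complex.norm_real, Real.norm_eq_abs, abs_of_nonneg (by linarith)]
    have h1 : (1 - r) ^ (2 * g + 1) ≤ 1 := pow_le_one₀ (by linarith) (by linarith)
    have h2 : (2 : ℝ) ≤ 2 ^ (2 * g + 1) := two_le_two_pow g
    nlinarith
  -- the path, in the page
  let γ : ↥(Icc (0 : ℝ) 1) → ↥(page g 1) := fun r =>
    ⟨⟨mk (a r) (b r), mk_mem_base_of_page (hw r) (ha r r.2)⟩, mk_mem_page (hw r) (ha r r.2)⟩
  have hcont : Continuous γ := by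
    refine Continuous.subtype_mk (Continuous.subtype_mk ?_ _) _
    have h1 : Continuous fun r : ↥(Icc (0 : ℝ) 1) => a r := by simp only [a]; fun_prop
    have h2 : Continuous fun r : ↥(Icc (0 : ℝ) 1) => b r := by
      simp only [b, ρ]
      refine continuous_const.mul ?_
      refine ContinuousOn.comp_continuous (s := {z : ℂ | 0 ≤ z.re})
        (fun z hz => (continuousAt_csqrt hz).continuousWithinAt) (by fun_prop) fun r => ?_
      show (0 : ℝ) ≤ (((3 / 2 * (1 - (1 - (r : ℝ)) ^ (2 * g + 1)) : ℝ) : ℂ)).re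
      rw [Complex.ofReal_re]
      have : (1 - (r : ℝ)) ^ (2 * g + 1) ≤ 1 := pow_le_one₀ (by linarith [r.2.2]) (by linarith [r.2.1])
      nlinarith
    exact continuous_mk.comp (h1.prodMk h2)
  refine ⟨⟨⟨γ, hcont⟩, ?_, ?_⟩⟩
  · apply Subtype.ext; apply Subtype.ext
    show mk (a 0) (b 0) = mk ζ 0
    simp [a, b, ρ]
  · apply Subtype.ext; apply Subtype.ext
    show mk (a 1) (b 1) = mk 0 (s * csqrt (3 / 2))
    simp [a, b, ρ]

/-- **The base page `page g 1` is path connected**: every point is joined inside `pageU` or `pageV`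
(by the deformations `homotopyPU`, `homotopyPV`) to a sheet point or a branch point, and these are
joined by `joined_secPV_secPU` (on paper: the page is the connected surface `F_{g,1}`).
[cite: Milnor1968, §9 Lemma 9.2] -/
theorem pathConnectedSpace_page (g : ℕ) : PathConnectedSpace ↥(page g 1) := by
  have hVU : ∀ (k : Fin (2 * g + 1)) (j : Fin 2), Joined (secPV g k).1 (secPU g j).1 := joined_secPV_secPU
  have hUU : ∀ j : Fin 2, Joined (secPU g j).1 (secPU g 0).1 := fun j =>
    (hVU ⟨0, Nat.succ_pos _⟩ j).symm.trans (hVU ⟨0, Nat.succ_pos _⟩ 0)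
  have key : ∀ q : ↥(page g 1), Joined q (secPU g 0).1 := by
    intro q
    rcases (show q ∈ pageU g ∪ pageV g by rw [pageU_union_pageV]; trivial) with hq | hq
    · have h1 : Joined (⟨q, hq⟩ : ↥(pageU g)) (secPU g (idxU (resPU g ⟨q, hq⟩))) :=
        joined_of_homotopy_id (homotopyPU g) ⟨q, hq⟩
      exact (joined_val_of_joined h1).trans (hUU _)
    · have h1 : Joined (⟨q, hq⟩ : ↥(pageV g)) (secPV g (idxV (resPV g ⟨q, hq⟩))) :=
        joined_of_homotopy_id (homotopyPV g) ⟨q, hq⟩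
      exact (joined_val_of_joined h1).trans (hVU _ 0)
  exact ⟨⟨(secPU g 0).1⟩, fun x y => (key x).trans (key y).symm⟩

/-- **`Hₖ(page g 1; M) ≅ Hₖ(Base g; M)` by the inclusion, in every degree** (degree `0`: both spaces
are path connected). [cite: Milnor1968, Thm. 9.1] -/
theorem isIso_map_pageIncl (g k : ℕ) :
    IsIso (singularHomology.map R M (⟨Subtype.val, continuous_subtype_val⟩ : C(↥(page g 1), Base g)) k) := by
  haveI := pathConnectedSpace_page g
  exact isIso_singularHomology_map_of_forall_isIso R M _ (mapsTo_pageU g) (mapsTo_pageV g)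
    (by rw [(isOpen_pageU g).interior_eq, (isOpen_pageV g).interior_eq, pageU_union_pageV])
    (by rw [(isOpen_coverU g).interior_eq, (isOpen_coverV g).interior_eq, coverU_union_coverV])
    (isIso_map_resPU R M g) (isIso_map_resPV R M g) (isIso_map_resPW R M g) k

/-! ## The registered sub-goal -/

/-- **Sub-goal `stub_Kas_page_iso` of stub `stub_modelsOn_counts`** (line `modp-braid-orbits`, r9):
design lemma (E) of Kas' presentation `H₁(∂X(F; l); ℤ) ≅ coker(wordProduct − 1)` — the page of
direction `1` carries the first homology of the base: `H₁(page g 1; ℤ) → H₁(Base g; ℤ)`, induced by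
the inclusion, is bijective (Milnor 1968, Thm. 9.1; Mayer–Vietoris comparison of the Milnor covers of
the page and of the base). [cite: Milnor1968, Thm. 9.1] -/
theorem stub_Kas_page_iso :
    ∀ g : ℕ, Function.Bijective (Literature.AlgebraicTopology.SingularHomology.singularHomology.map ℤ ℤ
      (⟨Subtype.val, continuous_subtype_val⟩ :
        C(↥(Literature.Topology.FourManifolds.LefschetzBase.page g 1),
          Literature.Topology.FourManifolds.LefschetzBase.Base g)) 1) :=
  bijective_map_pageIncl_one

end Summit.SmoothPoincare4.SmoothPoincare4.Theorems.AcyclicBisectionExists.ModpBraidOrbits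

end
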